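import Literature.Analysis.FluidPDE.TaoEnergyLocalisation
import Literature.Analysis.FluidPDE.LerayHopfProofs
import Mathlib.Analysis.FunctionalSpaces.SobolevInequality
import Literature.Analysis.FluidPDE.NormalisedPressure
import Literature.Analysis.FluidPDE.TaoEnstrophyLocalisationProofs
import HarnessLib

/-!
# Tao (2011/2013), Lemma 8.1 (global energy inequality) — layer 2: the localised energy
# inequality (65) from the pressure inputs (family `ns`, topic `Literature/Analysis/FluidPDE`)

Sibling of `TaoEnergyLocalisation.lean` (layer 1: cutoff `NS.taoCutoff`, localised energy and
dissipation, the named fact `NS.tao2011_localisedEnergyInequality` = Tao's (65) integrated in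
time, and the **proved** assembly `NS.tao_finite_energy_smooth_energy_bound_of_localisedEnergyInequality`
giving Lemma 8.1 = `NS.tao_finite_energy_smooth_energy_bound`). This file **proves** the layer-1
fact from the two inputs of the printed proof that concern the pressure:

* `NS.tao_pressure_normalisation` (tree, `NormalisedPressure.lean`; Tao's Lemma 4.1 (i), used in
  the proof of Lemma 8.1 as (54): "`∇p(t) = ∇p̃(t)` for almost all times `t`"), and
* `NS.tao2011_pressureTerm_estimate` (**named fact vendored here**, nothing asserted): the
  estimate of the pressure term `X₅ = 4∫ u p̃ η³∇η` of the localised energy identity (61)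
  (Tao 2011, §8, between (64) and (65)), in the `ν`-homogeneous absorbed form
  `|∫ p̃[v] D(θ⁸)(v)| ≤ ε X₁ + C (εA²/r² + A⁶/(ε³r⁴))` (`ε > 0`; Tao: `ν = 1`, `ε ≍ 1`).

Everything else in the printed proof of (65) is proved here: the derivative bound (58)
`∇θ = O(r⁻¹)` for `NS.taoCutoff` (`exists_norm_fderiv_taoCutoff_le`), the Sobolev step
"`‖uη²‖_{L⁶} ≲ ‖∇(uη²)‖_{L²} ≲ X₁^{1/2} + A/r`" (Mathlib's Gagliardo–Nirenberg–Sobolev inequality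
`MeasureTheory.eLpNorm_le_eLpNorm_fderiv_of_eq`; `integral_norm_taoCutoff_pow_four_smul_pow_six_le`),
the transport term (63) by Hölder/Cauchy–Schwarz and its absorption by Young's inequality
(`abs_integral_fderiv_taoCutoff_pow_apply_mul_norm_sq_le`, `half_transport_le`), the heat-flux /
viscous cross term (`abs_integral_sum_fderiv_taoCutoff_pow_mul_inner_le`, `neg_viscous_cross_le`;
we keep the term `∫ Σᵢ∂ᵢ(θ⁸)⟪∂ᵢu, u⟫` produced by one integration by parts and absorb it, instead
of integrating by parts twice as in Tao's `X₂ = ½∫|u|²Δ(η⁴) ≲ A²/r²`), the reduction of the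
pressure pairing to the normalised pressure (`integral_fderiv_apply_eq_zero_of_isDivFree`:
`∫ D(θ⁸)(u) = ∫ div(θ⁸u) = 0`, so the constant `C(t)` of (54) drops out; `pressure_slice_le`),
and the time integration ((61) integrated is the tree's
`Fluid.IsClassicalNSSolutionOn.energy_balance_cutoff`, so no differentiation under the integral
sign is needed; `tao2011_localisedEnergyInequality_of_pressure`). Net result:

  `tao_finite_energy_smooth_energy_bound_of_pressure :
     tao_pressure_normalisation → tao2011_pressureTerm_estimate → tao_finite_energy_smooth_energy_bound`.

## The bookkeeping (Tao 2011, §8, (61)–(65), with the viscosity restored)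

With `θ = taoCutoff R r` (`0 < r < R/2`), `φ = θ⁸` (Tao's `η⁴`, `η = θ²`), `‖Dθ‖ ≤ C₁/r`,
`∫|u(τ)|² ≤ A²`, `X₁(τ) = ∫ θ⁸|∇u(τ)|²`, `K` the Sobolev constant (`gnsConst3`) and `C₅` the
constant of the `X₅` fact, the slice bounds are
`½∫D(θ⁸)(u)|u|² ≤ (ν/8)X₁ + 2C₁²(νA²/r²) + 2²⁰C₁⁴K⁶(A⁶/(ν³r⁴))`,
`-ν∫Σᵢ∂ᵢ(θ⁸)⟪∂ᵢu,u⟫ ≤ (ν/8)X₁ + 384C₁²(νA²/r²)`, and for a.e. `τ`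
`∫ p D(θ⁸)(u) ≤ (ν/4)X₁ + (C₅/4)(νA²/r²) + 64C₅(A⁶/(ν³r⁴))`; with the energy balance
`E(t) - E(0) = ½∫₀ᵗ(transport) - ν∫₀ᵗX₁ - ν∫₀ᵗ(cross) + ∫₀ᵗ(pressure)` this gives (65) integrated,
`E(t) + (ν/2)∫₀ᵗX₁ ≤ E(0) + C(νA²/r² + A⁶/(ν³r⁴)) t`, `C = 386C₁² + 65C₅ + 2²⁰C₁⁴K⁶`.

## On the printed estimate of `X₅` (why the fact is the estimate of `X₅`, not the operator bound)

Tao splits `X₅ = X₅,₁ + X₅,₂`, `X₅,₂ = ∫ O(u [Δ⁻¹∇², η³](uu) ∇η)`, and bounds the commutator by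
"`[Δ⁻¹∇², χ³]` is a smoothing operator of infinite order (cf. [kato]), and in particular
`‖[Δ⁻¹∇², η³]f‖_{L²} ≲ ‖f‖_{L¹}` in the `r = 1` case". As an operator bound this is not correct:
the commutator of the order-`0` Calderón–Zygmund operator `Δ⁻¹∇²` with the smooth multiplier `η³`
has kernel `K(x-y)(η³(y) - η³(x)) ≍ r⁻¹|x-y|⁻²` near the diagonal, which is not in `L²_x(ℝ³)`
(`∫_{|z|<1}|z|⁻⁴dz = ∞`), so it does not map `L¹ → L²` (test `f` = a bump at a point where
`∇η ≠ 0`). The estimate of `X₅` survives with the same right-hand side: split the commutator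
kernel at `|x - y| = r`; the far part has `‖·‖_{L²_z} ≍ r^{-3/2}` and gives Tao's `A³r^{-5/2}`;
on the near part `|η³(x) - η³(y)| ≲ |x-y|/r`, the kernel `r⁻¹|z|⁻²1_{|z|<r}` lies in `L^{6/5}`
(norm `≍ r^{-1/2}`) and in weighted `L²`, and pairing `|u|² ∈ L¹` with `θ⁴u ∈ L⁶` (Sobolev) gives
`A² r^{-3/2}‖∇(θ⁴u)‖_{L²} + A³r^{-5/2} ≤ εX₁ + C(εA²/r² + A⁶/(ε³r⁴))` after Young/AM–GM
(`A⁴/(εr³)`, `A³/r^{5/2}` are geometric means of `εA²/r²` and `A⁶/(ε³r⁴)`). Hence the vendored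
statement (the bound for `X₅`) is true as stated, and (65), Lemma 8.1 are unaffected. Its proof
is the next layer: inputs are the `L²` bound `‖p̃[w]‖_{L²} ≲ ‖|w|²‖_{L²}` for `w ∈ C_c^∞`
(Stein 1970, Ch. III §1 — no singular integrals in Mathlib at this pin), the existence of the
principal values `NS.hasPressurePV_of_contDiff` (tree, named fact) and elementary kernel
integrals (`∫_{|z|≥r}|z|⁻⁶`, `∫_{|z|<r}|z|^{-12/5}`, `∫_{|z|<r}|z|⁻²`).

## Contents

* §CutoffDeriv: `hasFDerivAt_taoCutoff`, `exists_norm_fderiv_taoCutoff_le` ((58)), bounds for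
  `D(θ^{m+1})`, `D(θ⁴v)`.
* §Elementary / §LpNorm: Young, AM–GM with square roots (`mul_sqrt_pow_three_le`:
  `M√(D³) ≤ ηD² + M⁴/η³`), Cauchy–Schwarz for integrals, `eLpNorm ↔ ∫‖·‖ⁿ` conversions.
* §DivFree: `integral_fderiv_apply_eq_zero_of_isDivFree`.
* §Slice: the per-slice estimates listed above; `gnsConst3`.
* `tao2011_pressureTerm_estimate` (named fact); §Glue: `pressure_slice_le`, time integration
  helpers, `tao2011_localisedEnergyInequality_of_pressure`,
  `tao_finite_energy_smooth_energy_bound_of_pressure`.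

## Mathlib / tree search

`MeasureTheory.eLpNorm_le_eLpNorm_fderiv_of_eq`, `SNormLESNormFDerivOfEqConst` (GNS, used),
`MeasureTheory.integral_mul_le_Lp_mul_Lq_of_nonneg` (Hölder, used), `Real.smoothTransition.contDiff`,
`hasStrictFDerivAt_norm_sq`, `fderiv_fun_pow`, `MemLp.eLpNorm_eq_integral_rpow_norm` (used); tree:
`Fluid.IsClassicalNSSolutionOn.energy_balance_cutoff` (LerayHopfProofs; (61) integrated, used),
`Fluid.integral_divergence_eq_zero`, `Fluid.divergence_smul_apply` (WholeSpaceIBP/VectorCalculus,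
used), `Fluid.sq_opNorm_le_frobeniusNormSq` (used), `NS.normalisedPressure`,
`NS.tao_pressure_normalisation` (NormalisedPressure, used as hypothesis);
`lean search 'pressureTerm|Riesz|commutator'`: nothing relevant (`herglotzRieszKernel` is the
complex Poisson kernel).

## References

* T. Tao, *Localisation and compactness properties of the Navier–Stokes global regularity
  problem*, Anal. PDE 6 (2013) 25–107 = arXiv:1108.1165 (`Tao2011`): §8, Lemma 8.1 ("Lemma 44" of
  the arXiv text rendering, pp. 24–25) and its proof, (54)–(65); Lemma 4.1 (i).
* E. M. Stein, *Singular integrals and differentiability properties of functions* (1970),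
  Ch. II §4, Ch. III §1.
-/

noncomputable section

open MeasureTheory Set Filter Topology Function Metric
open scoped ENNReal NNReal RealInnerProductSpace ContDiff

namespace Literature.Analysis.FluidPDE

/-- Local notation for physical space `ℝ³ = EuclideanSpace ℝ (Fin 3)`. -/
local notation "ℝ³" => EuclideanSpace ℝ (Fin 3)

/-! ## Derivative bounds for Tao's cutoff ((58): `∇θ = O(r⁻¹)`) -/

section CutoffDeriv

/-- The derivative of `Real.smoothTransition` is bounded on `ℝ` (it is continuous and vanishes
off `[0, 1]`). [folklore] -/
theorem exists_abs_deriv_smoothTransition_le :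
    ∃ M : ℝ, 0 < M ∧ ∀ s : ℝ, |deriv Real.smoothTransition s| ≤ M := by
  have hC1 : ContDiff ℝ 1 Real.smoothTransition := Real.smoothTransition.contDiff (n := 1)
  have hcont : Continuous (deriv Real.smoothTransition) := hC1.continuous_deriv le_rfl
  -- the derivative vanishes off `[0, 1]`
  have hsupp : support (deriv Real.smoothTransition) ⊆ Icc (0 : ℝ) 1 := by
    intro s hs
    by_contra h
    apply hs
    rw [mem_Icc, not_and_or, not_le, not_le] at h
    rcases h with h | h
    · have : Real.smoothTransition =ᶠ[𝓝 s] fun _ => (0 : ℝ) := by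
        filter_upwards [Iio_mem_nhds h] with y hy
        exact Real.smoothTransition.zero_of_nonpos (le_of_lt hy)
      rw [this.deriv_eq, deriv_const]
    · have : Real.smoothTransition =ᶠ[𝓝 s] fun _ => (1 : ℝ) := by
        filter_upwards [Ioi_mem_nhds h] with y hy
        exact Real.smoothTransition.one_of_one_le (le_of_lt hy)
      rw [this.deriv_eq, deriv_const]
  have hcs : HasCompactSupport (deriv Real.smoothTransition) :=
    HasCompactSupport.of_support_subset_isCompact isCompact_Icc hsupp
  obtain ⟨M, hM⟩ := hcont.bounded_above_of_compact_support hcs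
  refine ⟨max M 1, lt_max_of_lt_right one_pos, fun s => ?_⟩
  exact (Real.norm_eq_abs _ ▸ hM s).trans (le_max_left _ _)

variable {E : Type*} [NormedAddCommGroup E] [InnerProductSpace ℝ E]

/-- The derivative of `θ_{R,r}` at `x`: chain rule through `s = (R² - |x|²)/(rR)`,
`Dθ(x) = χ'(s) · (-(2/(rR)) ⟨x, ·⟩)`. [folklore] -/
theorem hasFDerivAt_taoCutoff (R r : ℝ) (x : E) :
    HasFDerivAt (taoCutoff (E := E) R r)
      (deriv Real.smoothTransition ((R ^ 2 - ‖x‖ ^ 2) / (r * R)) •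
        ((-(2 / (r * R))) • innerSL ℝ x)) x := by
  have h1 : HasFDerivAt (fun y : E => ‖y‖ ^ 2) ((2 : ℝ) • innerSL ℝ x) x := by
    have := (hasStrictFDerivAt_norm_sq x).hasFDerivAt
    convert this using 1
    ext u
    simp [two_smul]
  have h2 : HasFDerivAt (fun y : E => R ^ 2 - ‖y‖ ^ 2) (0 - (2 : ℝ) • innerSL ℝ x) x :=
    (hasFDerivAt_const (R ^ 2) x).sub h1
  have h3 := h2.const_mul (r * R)⁻¹
  have hg : HasFDerivAt (fun y : E => (R ^ 2 - ‖y‖ ^ 2) / (r * R))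
      ((-(2 / (r * R))) • innerSL ℝ x) x := by
    have heq : (fun y : E => (r * R)⁻¹ * (R ^ 2 - ‖y‖ ^ 2)) =
        fun y : E => (R ^ 2 - ‖y‖ ^ 2) / (r * R) := by
      funext y; rw [div_eq_inv_mul]
    rw [heq] at h3
    refine h3.congr_fderiv ?_
    ext u
    simp only [FunLike.coe_smul, Pi.smul_apply, FunLike.coe_sub, Pi.sub_apply, zero_apply,
      smul_eq_mul]
    ring
  have hST : HasDerivAt Real.smoothTransition
      (deriv Real.smoothTransition ((R ^ 2 - ‖x‖ ^ 2) / (r * R))) ((R ^ 2 - ‖x‖ ^ 2) / (r * R)) :=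
    ((Real.smoothTransition.contDiff (n := 1)).differentiable one_ne_zero _).hasDerivAt
  exact hST.comp_hasFDerivAt x hg

/-- **(58): `∇θ = O(r⁻¹)`.** There is an absolute constant `C₁ > 0` with
`‖Dθ_{R,r}(x)‖ ≤ C₁ / r` for all `x`, whenever `0 < r` and `0 < R` (the derivative lives on
`|x| ≤ R`, where `|∇((R² - |x|²)/(rR))| = 2|x|/(rR) ≤ 2/r`). [cite: Tao2011, §8, proof of Lemma 8.1, (58)] -/
theorem exists_norm_fderiv_taoCutoff_le :
    ∃ C₁ : ℝ, 0 < C₁ ∧ ∀ (R r : ℝ), 0 < r → 0 < R →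
      ∀ x : E, ‖fderiv ℝ (taoCutoff R r) x‖ ≤ C₁ / r := by
  obtain ⟨M, hM0, hM⟩ := exists_abs_deriv_smoothTransition_le
  refine ⟨2 * M, by positivity, fun R r hr hR x => ?_⟩
  rw [(hasFDerivAt_taoCutoff R r x).fderiv]
  set s : ℝ := (R ^ 2 - ‖x‖ ^ 2) / (r * R) with hs
  by_cases hx : R ≤ ‖x‖
  · -- off the ball the derivative of `smoothTransition` vanishes
    have hs0 : s ≤ 0 := by
      rw [hs]
      apply div_nonpos_of_nonpos_of_nonneg
      · nlinarith [norm_nonneg x]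
      · positivity
    have hd : deriv Real.smoothTransition s = 0 := by
      rcases lt_or_eq_of_le hs0 with h | h
      · have : Real.smoothTransition =ᶠ[𝓝 s] fun _ => (0 : ℝ) := by
          filter_upwards [Iio_mem_nhds h] with y hy
          exact Real.smoothTransition.zero_of_nonpos (le_of_lt hy)
        rw [this.deriv_eq, deriv_const]
      · -- at `s = 0` the function has a minimum, so the derivative vanishes
        have hmin : IsLocalMin Real.smoothTransition s := by
          filter_upwards with y
          rw [h, Real.smoothTransition.zero]
          exact Real.smoothTransition.nonneg y
        exact hmin.deriv_eq_zero
    rw [hd, zero_smul, norm_zero]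
    positivity
  · push Not at hx
    have hrR : 0 < r * R := mul_pos hr hR
    calc ‖deriv Real.smoothTransition s • ((-(2 / (r * R))) • innerSL ℝ x)‖
        = |deriv Real.smoothTransition s| * (2 / (r * R) * ‖x‖) := by
          rw [norm_smul, Real.norm_eq_abs, norm_smul, norm_neg, innerSL_apply_norm,
            Real.norm_eq_abs, abs_of_pos (by positivity : (0 : ℝ) < 2 / (r * R))]
      _ ≤ M * (2 / (r * R) * R) := by
          gcongr
          · exact hM s
      _ = 2 * M / r := by
          field_simp

variable {R r : ℝ}

/-- Gradient bound for the powers of the cutoff: `|D(θ^{m+1})(x) u| ≤ (m+1) θ(x)^m (C₁/r) ‖u‖`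
whenever `‖Dθ‖ ≤ C₁/r`. [folklore] -/
theorem abs_fderiv_taoCutoff_pow_apply_le {C₁ : ℝ}
    (hC : ∀ x : E, ‖fderiv ℝ (taoCutoff R r) x‖ ≤ C₁ / r) (m : ℕ) (x u : E) :
    |fderiv ℝ (fun y => taoCutoff R r y ^ (m + 1)) x u| ≤
      (m + 1) * taoCutoff R r x ^ m * (C₁ / r) * ‖u‖ := by
  have hd : DifferentiableAt ℝ (taoCutoff (E := E) R r) x :=
    ((contDiff_taoCutoff (n := 1) R r).differentiable one_ne_zero) x
  rw [fderiv_fun_pow (m + 1) hd]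
  simp only [Nat.add_sub_cancel, nsmul_eq_mul, Nat.cast_add, Nat.cast_one,
    FunLike.coe_smul, Pi.smul_apply, smul_eq_mul]
  have h0 : 0 ≤ ((m : ℝ) + 1) * taoCutoff R r x ^ m := by
    have := taoCutoff_nonneg R r x
    positivity
  rw [abs_mul, abs_of_nonneg h0, mul_assoc (((m : ℝ) + 1) * taoCutoff R r x ^ m)]
  refine mul_le_mul_of_nonneg_left ?_ h0
  exact (Real.norm_eq_abs _ ▸ (fderiv ℝ (taoCutoff R r) x).le_opNorm u).trans
    (mul_le_mul_of_nonneg_right (hC x) (norm_nonneg _))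

/-- The case `m + 1 = 8`: `|D(θ⁸)(x) u| ≤ 8 θ(x)⁷ (C₁/r) ‖u‖`. [folklore] -/
theorem abs_fderiv_taoCutoff_pow_eight_apply_le {C₁ : ℝ}
    (hC : ∀ x : E, ‖fderiv ℝ (taoCutoff R r) x‖ ≤ C₁ / r) (x u : E) :
    |fderiv ℝ (fun y => taoCutoff R r y ^ 8) x u| ≤
      8 * taoCutoff R r x ^ 7 * (C₁ / r) * ‖u‖ := by
  have := abs_fderiv_taoCutoff_pow_apply_le hC 7 x u
  norm_num at this
  exact this

/-- Derivative bound for `θ⁴ v`: `‖D(θ⁴ v)(x)‖ ≤ θ⁴ ‖Dv(x)‖ + 4 θ³ (C₁/r) ‖v(x)‖`. [folklore] -/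
theorem norm_fderiv_taoCutoff_pow_four_smul_le {F : Type*} [NormedAddCommGroup F] [NormedSpace ℝ F]
    {C₁ : ℝ} (hC : ∀ x : E, ‖fderiv ℝ (taoCutoff R r) x‖ ≤ C₁ / r) (hC0 : 0 ≤ C₁ / r)
    {v : E → F} (hv : ContDiff ℝ 1 v) (x : E) :
    ‖fderiv ℝ (fun y => taoCutoff R r y ^ 4 • v y) x‖ ≤
      taoCutoff R r x ^ 4 * ‖fderiv ℝ v x‖ + 4 * taoCutoff R r x ^ 3 * (C₁ / r) * ‖v x‖ := by
  have hθ4 : DifferentiableAt ℝ (fun y => taoCutoff (E := E) R r y ^ 4) x :=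
    ((contDiff_taoCutoff_pow (n := 1) R r 4).differentiable one_ne_zero) x
  have hvx : DifferentiableAt ℝ v x := (hv.differentiable one_ne_zero) x
  rw [fderiv_fun_smul hθ4 hvx]
  calc ‖taoCutoff R r x ^ 4 • fderiv ℝ v x +
        (fderiv ℝ (fun y => taoCutoff R r y ^ 4) x).smulRight (v x)‖
      ≤ ‖taoCutoff R r x ^ 4 • fderiv ℝ v x‖ +
          ‖(fderiv ℝ (fun y => taoCutoff R r y ^ 4) x).smulRight (v x)‖ := norm_add_le _ _
    _ ≤ taoCutoff R r x ^ 4 * ‖fderiv ℝ v x‖ + 4 * taoCutoff R r x ^ 3 * (C₁ / r) * ‖v x‖ := by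
        gcongr
        · rw [norm_smul, Real.norm_eq_abs, abs_of_nonneg (taoCutoff_pow_nonneg R r x 4)]
        · rw [ContinuousLinearMap.norm_smulRight_apply]
          refine mul_le_mul_of_nonneg_right ?_ (norm_nonneg _)
          refine ContinuousLinearMap.opNorm_le_bound _ ?_ fun u => ?_
          · have := taoCutoff_nonneg R r x
            positivity
          · have := abs_fderiv_taoCutoff_pow_apply_le hC 3 x u
            rw [Real.norm_eq_abs]
            norm_num at this ⊢
            linarith

end CutoffDeriv

/-! ## Elementary inequalities -/

section Elementary

/-- Young: `ab ≤ (δ/2) a² + b²/(2δ)`. [folklore] -/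
theorem mul_le_half_mul_sq_add {δ : ℝ} (hδ : 0 < δ) (a b : ℝ) :
    a * b ≤ δ / 2 * a ^ 2 + b ^ 2 / (2 * δ) := by
  rw [show δ / 2 * a ^ 2 + b ^ 2 / (2 * δ) = ((δ * a) ^ 2 + b ^ 2) / (2 * δ) by
    field_simp]
  rw [le_div_iff₀ (by positivity)]
  nlinarith [sq_nonneg (δ * a - b)]

/-- AM–GM with square roots: `√(XY) ≤ (X + Y)/2`. [folklore] -/
theorem sqrt_mul_le_add_half {X Y : ℝ} (hX : 0 ≤ X) (hY : 0 ≤ Y) :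
    Real.sqrt (X * Y) ≤ (X + Y) / 2 := by
  rw [Real.sqrt_mul hX]
  nlinarith [sq_nonneg (Real.sqrt X - Real.sqrt Y), Real.sq_sqrt hX, Real.sq_sqrt hY,
    Real.sqrt_nonneg X, Real.sqrt_nonneg Y]

/-- The absorption step `M D^{3/2} ≤ η D² + M⁴/η³` (weighted AM–GM, written with square roots:
`M √(D³) = √((ηD²)(M²D/η))` and `M²D/η = √((ηD²)(M⁴/η³))`). [folklore] -/
theorem mul_sqrt_pow_three_le {D M η : ℝ} (hD : 0 ≤ D) (hM : 0 ≤ M) (hη : 0 < η) :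
    M * Real.sqrt (D ^ 3) ≤ η * D ^ 2 + M ^ 4 / η ^ 3 := by
  have h1 : M * Real.sqrt (D ^ 3) = Real.sqrt ((η * D ^ 2) * (M ^ 2 * D / η)) := by
    rw [show (η * D ^ 2) * (M ^ 2 * D / η) = M ^ 2 * D ^ 3 by field_simp,
      Real.sqrt_mul (sq_nonneg M), Real.sqrt_sq hM]
  have h2 : M ^ 2 * D / η = Real.sqrt ((η * D ^ 2) * (M ^ 4 / η ^ 3)) := by
    rw [show (η * D ^ 2) * (M ^ 4 / η ^ 3) = (M ^ 2 * D / η) ^ 2 by field_simp,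
      Real.sqrt_sq (by positivity)]
  have i1 := sqrt_mul_le_add_half (X := η * D ^ 2) (Y := M ^ 2 * D / η) (by positivity)
    (by positivity)
  have i2 := sqrt_mul_le_add_half (X := η * D ^ 2) (Y := M ^ 4 / η ^ 3) (by positivity)
    (by positivity)
  rw [← h1] at i1
  rw [← h2] at i2
  have h3 : 0 ≤ η * D ^ 2 := by positivity
  have h4 : 0 ≤ M ^ 4 / η ^ 3 := by positivity
  linarith

variable {α : Type*} [MeasurableSpace α] {μ : Measure α}

/-- Cauchy–Schwarz for real integrals of nonnegative functions:
`∫ f g ≤ √(∫ f²) √(∫ g²)`. [folklore] -/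
theorem integral_mul_le_sqrt_mul_sqrt {f g : α → ℝ} (hf0 : ∀ x, 0 ≤ f x) (hg0 : ∀ x, 0 ≤ g x)
    (hfm : AEStronglyMeasurable f μ) (hgm : AEStronglyMeasurable g μ)
    (hf : Integrable (fun x => f x ^ 2) μ) (hg : Integrable (fun x => g x ^ 2) μ) :
    ∫ x, f x * g x ∂μ ≤ Real.sqrt (∫ x, f x ^ 2 ∂μ) * Real.sqrt (∫ x, g x ^ 2 ∂μ) := by
  have h := integral_mul_le_Lp_mul_Lq_of_nonneg (μ := μ) Real.HolderConjugate.two_two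
    (Eventually.of_forall hf0) (Eventually.of_forall hg0)
    (by rw [ENNReal.ofReal_ofNat]; exact (memLp_two_iff_integrable_sq hfm).2 hf)
    (by rw [ENNReal.ofReal_ofNat]; exact (memLp_two_iff_integrable_sq hgm).2 hg)
  simp only [Real.rpow_two] at h
  rwa [Real.sqrt_eq_rpow, Real.sqrt_eq_rpow]

end Elementary

/-! ## Lebesgue-norm bookkeeping -/

section LpNorm

variable {α : Type*} [MeasurableSpace α] {μ : Measure α} {F : Type*} [NormedAddCommGroup F]

/-- For `f ∈ L^n`, `n ≥ 1` an integer, `‖f‖_{L^n} = ofReal ((∫ ‖f‖^n)^{1/n})`. [folklore] -/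
theorem eLpNorm_natCast_eq_ofReal {f : α → F} {n : ℕ} (hn : n ≠ 0) (hf : MemLp f n μ) :
    eLpNorm f n μ = ENNReal.ofReal ((∫ x, ‖f x‖ ^ n ∂μ) ^ (n : ℝ)⁻¹) := by
  rw [hf.eLpNorm_eq_integral_rpow_norm (by exact_mod_cast hn) (ENNReal.natCast_ne_top n)]
  simp only [ENNReal.toReal_natCast, Real.rpow_natCast]

/-- From `‖f‖_{L^n} ≤ ofReal B` (`B ≥ 0`) to `∫ ‖f‖^n ≤ B^n`. [folklore] -/
theorem integral_norm_pow_le_of_eLpNorm_le {f : α → F} {n : ℕ} (hn : n ≠ 0) (hf : MemLp f n μ)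
    {B : ℝ} (hB : 0 ≤ B) (h : eLpNorm f n μ ≤ ENNReal.ofReal B) :
    ∫ x, ‖f x‖ ^ n ∂μ ≤ B ^ n := by
  rw [eLpNorm_natCast_eq_ofReal hn hf, ENNReal.ofReal_le_ofReal_iff hB] at h
  have h0 : 0 ≤ ∫ x, ‖f x‖ ^ n ∂μ := integral_nonneg fun x => by positivity
  calc ∫ x, ‖f x‖ ^ n ∂μ = ((∫ x, ‖f x‖ ^ n ∂μ) ^ (n : ℝ)⁻¹) ^ n :=
        (Real.rpow_inv_natCast_pow h0 hn).symm
    _ ≤ B ^ n := pow_le_pow_left₀ (Real.rpow_nonneg h0 _) h n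

/-- `‖f‖_{L²} ≤ ofReal (√B)` when `∫ ‖f‖² ≤ B`. [folklore] -/
theorem eLpNorm_two_le_ofReal_sqrt {f : α → F} (hf : MemLp f 2 μ) {B : ℝ}
    (h : ∫ x, ‖f x‖ ^ 2 ∂μ ≤ B) : eLpNorm f 2 μ ≤ ENNReal.ofReal (Real.sqrt B) := by
  have := eLpNorm_natCast_eq_ofReal (n := 2) two_ne_zero (by exact_mod_cast hf)
  rw [Nat.cast_ofNat] at this
  rw [this]
  refine ENNReal.ofReal_le_ofReal ?_
  rw [show ((2 : ℕ) : ℝ)⁻¹ = 1 / 2 by norm_num, ← Real.sqrt_eq_rpow]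
  exact Real.sqrt_le_sqrt h

end LpNorm

/-! ## The pressure pairing only sees `∇p` -/

section DivFree

variable {E : Type*} [NormedAddCommGroup E] [InnerProductSpace ℝ E] [FiniteDimensional ℝ E]
  [MeasurableSpace E] [BorelSpace E]

/-- For a divergence-free `C¹` field `v` and a `C¹_c` cutoff `φ`, `∫ Dφ(x)(v(x)) dx = 0`
(`Dφ·v = div(φ v)` and the boundary-free divergence theorem): adding a constant to the pressure
does not change `∫ p (Dφ·v)`. [folklore] -/
theorem integral_fderiv_apply_eq_zero_of_isDivFree {v : E → E} (hv : ContDiff ℝ 1 v)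
    (hdiv : VectorCalculus.IsDivFree v) {φ : E → ℝ} (hφ : ContDiff ℝ 1 φ) (hφc : HasCompactSupport φ) :
    ∫ x, fderiv ℝ φ x (v x) = 0 := by
  have key : ∀ x, fderiv ℝ φ x (v x) = VectorCalculus.divergence (fun y => φ y • v y) x := by
    intro x
    rw [FluidPDE.divergence_smul_apply (hφ.differentiable one_ne_zero x)
      (hv.differentiable one_ne_zero x), hdiv x, mul_zero, zero_add,
      FluidPDE.inner_gradient_right_eq_fderiv]
  simp_rw [key]
  exact FluidPDE.integral_divergence_eq_zero (hφ.smul hv) hφc.smul_right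

end DivFree

/-! ## Slice estimates for a fixed velocity field on `ℝ³` -/

section Slice

variable {R r A C₁ : ℝ} {v : ℝ³ → ℝ³}

/-- **Sobolev step ((62)–(63): `‖u η²‖_{L⁶} ≲ ‖∇(u η²)‖_{L²} ≲ X₁^{1/2} + r⁻¹ A`).** With
`θ = θ_{R,r}`, `X₁ = ∫ θ⁸ |∇v|²` and `∫ |v|² ≤ A²`:
`∫ |θ⁴ v|⁶ ≤ (K √(2X₁ + 32 (C₁/r)² A²))⁶`, `K` the Gagliardo–Nirenberg–Sobolev constant of
Mathlib (`‖w‖_{L⁶} ≤ K ‖∇w‖_{L²}` for `w = θ⁴ v ∈ C¹_c`, and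
`|∇(θ⁴v)|² ≤ 2θ⁸|∇v|² + 32 (C₁/r)² |v|²`). [cite: Tao2011, §8, proof of Lemma 8.1, (62)–(63)] -/
theorem integral_norm_taoCutoff_pow_four_smul_pow_six_le (hv : ContDiff ℝ 1 v)
    (hv2 : Integrable fun x => ‖v x‖ ^ 2) (hA : ∫ x, ‖v x‖ ^ 2 ≤ A ^ 2) (hr : 0 < r) (hR : 0 < R)
    (hC : ∀ x : ℝ³, ‖fderiv ℝ (taoCutoff R r) x‖ ≤ C₁ / r) (hC0 : 0 ≤ C₁) :
    ∫ x, ‖taoCutoff R r x ^ 4 • v x‖ ^ 6 ≤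
      ((SNormLESNormFDerivOfEqConst ℝ³ (volume : Measure ℝ³) 2 : ℝ) *
        Real.sqrt (2 * localisedDissipation (fun x => taoCutoff R r x ^ 8) v +
          32 * (C₁ / r) ^ 2 * A ^ 2)) ^ 6 := by
  set θ : ℝ³ → ℝ := taoCutoff R r with hθ
  set w : ℝ³ → ℝ³ := fun x => θ x ^ 4 • v x with hw
  set K : ℝ≥0 := SNormLESNormFDerivOfEqConst ℝ³ (volume : Measure ℝ³) 2 with hK
  set X₁ : ℝ := localisedDissipation (fun x => θ x ^ 8) v with hX₁
  have hw1 : ContDiff ℝ 1 w := (contDiff_taoCutoff_pow R r 4).smul hv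
  have hwc : HasCompactSupport w :=
    (hasCompactSupport_taoCutoff_pow hR.le hr.le (by norm_num : (4 : ℕ) ≠ 0)).smul_right
  have hCr : 0 ≤ C₁ / r := div_nonneg hC0 hr.le
  have hX₁0 : 0 ≤ X₁ := localisedDissipation_nonneg (fun x => taoCutoff_pow_nonneg R r x 8) v
  -- Gagliardo–Nirenberg–Sobolev for the compactly supported `w`
  have hGNS : eLpNorm w 6 volume ≤ K * eLpNorm (fderiv ℝ w) 2 volume := by
    have h := eLpNorm_le_eLpNorm_fderiv_of_eq (volume : Measure ℝ³) hw1 hwc (p := 2) (p' := 6)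
      one_le_two (by rw [finrank_euclideanSpace_fin]; norm_num)
      (by rw [finrank_euclideanSpace_fin]; push_cast; norm_num)
    exact_mod_cast h
  -- the derivative of `w` in `L²`
  have hDw : ∀ x, ‖fderiv ℝ w x‖ ^ 2 ≤
      2 * (θ x ^ 8 * FluidPDE.frobeniusNormSq (fderiv ℝ v x)) + 32 * (C₁ / r) ^ 2 * ‖v x‖ ^ 2 := by
    intro x
    have h1 := norm_fderiv_taoCutoff_pow_four_smul_le hC hCr hv x
    have hθ0 : 0 ≤ θ x := taoCutoff_nonneg R r x
    have hθ1 : θ x ≤ 1 := taoCutoff_le_one R r x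
    have hop : ‖fderiv ℝ v x‖ ^ 2 ≤ FluidPDE.frobeniusNormSq (fderiv ℝ v x) :=
      FluidPDE.sq_opNorm_le_frobeniusNormSq _
    have hθ6 : θ x ^ 6 ≤ 1 := pow_le_one₀ hθ0 hθ1
    have ha : 0 ≤ θ x ^ 4 * ‖fderiv ℝ v x‖ := by positivity
    have hb : 0 ≤ 4 * θ x ^ 3 * (C₁ / r) * ‖v x‖ := by positivity
    calc ‖fderiv ℝ w x‖ ^ 2
        ≤ (θ x ^ 4 * ‖fderiv ℝ v x‖ + 4 * θ x ^ 3 * (C₁ / r) * ‖v x‖) ^ 2 :=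
          pow_le_pow_left₀ (norm_nonneg _) h1 2
      _ ≤ 2 * (θ x ^ 4 * ‖fderiv ℝ v x‖) ^ 2 + 2 * (4 * θ x ^ 3 * (C₁ / r) * ‖v x‖) ^ 2 := by
          nlinarith [sq_nonneg (θ x ^ 4 * ‖fderiv ℝ v x‖ - 4 * θ x ^ 3 * (C₁ / r) * ‖v x‖)]
      _ = 2 * (θ x ^ 8 * ‖fderiv ℝ v x‖ ^ 2) + 32 * (C₁ / r) ^ 2 * (θ x ^ 6 * ‖v x‖ ^ 2) := by
          ring
      _ ≤ 2 * (θ x ^ 8 * FluidPDE.frobeniusNormSq (fderiv ℝ v x)) +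
            32 * (C₁ / r) ^ 2 * (1 * ‖v x‖ ^ 2) := by
          gcongr
      _ = _ := by rw [one_mul]
  have hi1 : Integrable (fun x => θ x ^ 8 * FluidPDE.frobeniusNormSq (fderiv ℝ v x)) :=
    (((continuous_taoCutoff R r).pow 8).mul
      (FluidPDE.continuous_frobeniusNormSq_fderiv hv one_ne_zero)).integrable_of_hasCompactSupport
      ((hasCompactSupport_taoCutoff_pow hR.le hr.le (by norm_num : (8 : ℕ) ≠ 0)).mul_right)
  have hcs : HasCompactSupport (fun x => ‖fderiv ℝ w x‖ ^ 2) :=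
    (hwc.fderiv ℝ).mono fun x hx => by
      rw [mem_support] at hx ⊢
      contrapose! hx
      rw [hx, norm_zero, zero_pow two_ne_zero]
  have hiDw : Integrable (fun x => ‖fderiv ℝ w x‖ ^ 2) :=
    ((hw1.continuous_fderiv one_ne_zero).norm.pow 2).integrable_of_hasCompactSupport hcs
  have hint : ∫ x, ‖fderiv ℝ w x‖ ^ 2 ≤ 2 * X₁ + 32 * (C₁ / r) ^ 2 * A ^ 2 := by
    calc ∫ x, ‖fderiv ℝ w x‖ ^ 2
        ≤ ∫ x, (2 * (θ x ^ 8 * FluidPDE.frobeniusNormSq (fderiv ℝ v x)) +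
            32 * (C₁ / r) ^ 2 * ‖v x‖ ^ 2) :=
          integral_mono hiDw ((hi1.const_mul 2).add (hv2.const_mul _)) hDw
      _ = 2 * X₁ + 32 * (C₁ / r) ^ 2 * ∫ x, ‖v x‖ ^ 2 := by
          rw [integral_add (hi1.const_mul 2) (hv2.const_mul _), integral_const_mul,
            integral_const_mul, hX₁, localisedDissipation]
      _ ≤ 2 * X₁ + 32 * (C₁ / r) ^ 2 * A ^ 2 := by gcongr
  set D : ℝ := Real.sqrt (2 * X₁ + 32 * (C₁ / r) ^ 2 * A ^ 2) with hD
  have hD0 : 0 ≤ D := Real.sqrt_nonneg _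
  have hDw2 : eLpNorm (fderiv ℝ w) 2 volume ≤ ENNReal.ofReal D :=
    eLpNorm_two_le_ofReal_sqrt
      (((hw1.continuous_fderiv one_ne_zero).memLp_of_hasCompactSupport (hwc.fderiv ℝ))) hint
  -- conclusion
  have hw6 : eLpNorm w 6 volume ≤ ENNReal.ofReal (K * D) := by
    calc eLpNorm w 6 volume ≤ K * eLpNorm (fderiv ℝ w) 2 volume := hGNS
      _ ≤ K * ENNReal.ofReal D := by gcongr
      _ = ENNReal.ofReal (K * D) := by
          rw [ENNReal.ofReal_mul K.coe_nonneg, ENNReal.ofReal_coe_nnreal]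
  have hmem6 : MemLp w (6 : ℕ) volume := hw1.continuous.memLp_of_hasCompactSupport hwc
  have := integral_norm_pow_le_of_eLpNorm_le (n := 6) (by norm_num) hmem6
    (mul_nonneg K.coe_nonneg hD0) (by exact_mod_cast hw6)
  simpa [hw] using this

/-- Integrability of continuous functions against a power `θⁿ`, `n ≠ 0`, of the cutoff. [folklore] -/
theorem integrable_taoCutoff_pow_mul {n : ℕ} (hn : n ≠ 0) (hr : 0 ≤ r) (hR : 0 ≤ R) {g : ℝ³ → ℝ}
    (hg : Continuous g) : Integrable fun x => taoCutoff R r x ^ n * g x :=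
  (((continuous_taoCutoff R r).pow n).mul hg).integrable_of_hasCompactSupport
    ((hasCompactSupport_taoCutoff_pow hR hr hn).mul_right)

/-- **Transport term ((61), `X₃`; Tao: `X₃ ≲ r⁻¹ ‖u η²‖^{3/2}_{L⁶} ‖u‖^{3/2}_{L²}`, (63)).**
`|∫ D(θ⁸)(v) |v|²| ≤ 8 (C₁/r) ∫ θ⁷|v|³ ≤ 8 (C₁/r) A (A (∫|θ⁴v|⁶)^{1/2})^{1/2}` — two applications
of the Cauchy–Schwarz inequality (`θ⁷|v|³ = (θ|v|)(θ⁶|v|²)`, `θ¹²|v|⁴ = |v| (θ¹²|v|³)`).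
[cite: Tao2011, §8, proof of Lemma 8.1, (63)] -/
theorem abs_integral_fderiv_taoCutoff_pow_apply_mul_norm_sq_le (hv : ContDiff ℝ 1 v)
    (hv2 : Integrable fun x => ‖v x‖ ^ 2) (hA : ∫ x, ‖v x‖ ^ 2 ≤ A ^ 2) (hA0 : 0 ≤ A)
    (hr : 0 < r) (hR : 0 < R) (hC : ∀ x : ℝ³, ‖fderiv ℝ (taoCutoff R r) x‖ ≤ C₁ / r)
    (hC0 : 0 ≤ C₁) :
    |∫ x, fderiv ℝ (fun y => taoCutoff R r y ^ 8) x (v x) * ‖v x‖ ^ 2| ≤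
      8 * (C₁ / r) * (A * Real.sqrt (A * Real.sqrt (∫ x, ‖taoCutoff R r x ^ 4 • v x‖ ^ 6))) := by
  set θ : ℝ³ → ℝ := taoCutoff R r with hθ
  have hθ0 : ∀ x, 0 ≤ θ x := fun x => taoCutoff_nonneg R r x
  have hθ1 : ∀ x, θ x ≤ 1 := fun x => taoCutoff_le_one R r x
  have hCr : 0 ≤ C₁ / r := div_nonneg hC0 hr.le
  have hvc : Continuous v := hv.continuous
  have hφ1 : ContDiff ℝ 1 (fun y => θ y ^ 8) := contDiff_taoCutoff_pow R r 8
  have hφc : HasCompactSupport (fun y => θ y ^ 8) :=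
    hasCompactSupport_taoCutoff_pow hR.le hr.le (by norm_num)
  -- Cauchy–Schwarz, twice
  have hI6 : 0 ≤ ∫ x, ‖θ x ^ 4 • v x‖ ^ 6 := integral_nonneg fun x => by positivity
  have hJ4 : ∫ x, θ x ^ 12 * ‖v x‖ ^ 4 ≤ A * Real.sqrt (∫ x, ‖θ x ^ 4 • v x‖ ^ 6) := by
    have h := integral_mul_le_sqrt_mul_sqrt (μ := volume) (f := fun x => ‖v x‖)
      (g := fun x => θ x ^ 12 * ‖v x‖ ^ 3) (fun x => norm_nonneg _)
      (fun x => by have := hθ0 x; positivity) hvc.norm.aestronglyMeasurable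
      (((continuous_taoCutoff R r).pow 12).mul (hvc.norm.fun_pow 3)).aestronglyMeasurable hv2
      (by
        have := integrable_taoCutoff_pow_mul (n := 24) (by norm_num) hr.le hR.le (hvc.norm.fun_pow 6)
        refine this.congr (Eventually.of_forall fun x => ?_)
        simp only [hθ]
        ring)
    have h1 : (fun x => ‖v x‖ * (θ x ^ 12 * ‖v x‖ ^ 3)) = fun x => θ x ^ 12 * ‖v x‖ ^ 4 := by
      funext x; ring
    have h2 : (fun x => (θ x ^ 12 * ‖v x‖ ^ 3) ^ 2) = fun x => ‖θ x ^ 4 • v x‖ ^ 6 := by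
      funext x
      rw [norm_smul, Real.norm_eq_abs, abs_of_nonneg (pow_nonneg (hθ0 x) 4)]
      ring
    rw [h1, h2] at h
    refine h.trans ?_
    gcongr
    calc Real.sqrt (∫ x, ‖v x‖ ^ 2) ≤ Real.sqrt (A ^ 2) := Real.sqrt_le_sqrt hA
      _ = A := Real.sqrt_sq hA0
  have hJ3 : ∫ x, θ x ^ 7 * ‖v x‖ ^ 3 ≤
      A * Real.sqrt (A * Real.sqrt (∫ x, ‖θ x ^ 4 • v x‖ ^ 6)) := by
    have h := integral_mul_le_sqrt_mul_sqrt (μ := volume) (f := fun x => θ x * ‖v x‖)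
      (g := fun x => θ x ^ 6 * ‖v x‖ ^ 2) (fun x => by have := hθ0 x; positivity)
      (fun x => by have := hθ0 x; positivity)
      ((continuous_taoCutoff R r).mul hvc.norm).aestronglyMeasurable
      (((continuous_taoCutoff R r).pow 6).mul (hvc.norm.fun_pow 2)).aestronglyMeasurable
      (by
        have := integrable_taoCutoff_pow_mul (n := 2) (by norm_num) hr.le hR.le (hvc.norm.fun_pow 2)
        refine this.congr (Eventually.of_forall fun x => ?_)
        simp only [hθ]
        ring)
      (by
        have := integrable_taoCutoff_pow_mul (n := 12) (by norm_num) hr.le hR.le (hvc.norm.fun_pow 4)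
        refine this.congr (Eventually.of_forall fun x => ?_)
        simp only [hθ]
        ring)
    have h1 : (fun x => θ x * ‖v x‖ * (θ x ^ 6 * ‖v x‖ ^ 2)) = fun x => θ x ^ 7 * ‖v x‖ ^ 3 := by
      funext x; ring
    have h2 : (fun x => (θ x ^ 6 * ‖v x‖ ^ 2) ^ 2) = fun x => θ x ^ 12 * ‖v x‖ ^ 4 := by
      funext x; ring
    rw [h1, h2] at h
    refine h.trans ?_
    have h3 : Real.sqrt (∫ x, (θ x * ‖v x‖) ^ 2) ≤ A := by
      calc Real.sqrt (∫ x, (θ x * ‖v x‖) ^ 2) ≤ Real.sqrt (A ^ 2) := by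
            refine Real.sqrt_le_sqrt (le_trans ?_ hA)
            refine integral_mono ?_ hv2 fun x => ?_
            · have := integrable_taoCutoff_pow_mul (n := 2) (by norm_num) hr.le hR.le
                (hvc.norm.fun_pow 2)
              refine this.congr (Eventually.of_forall fun x => ?_)
              simp only [hθ]
              ring
            · have : θ x ^ 2 ≤ 1 := pow_le_one₀ (hθ0 x) (hθ1 x)
              calc (θ x * ‖v x‖) ^ 2 = θ x ^ 2 * ‖v x‖ ^ 2 := by ring
                _ ≤ 1 * ‖v x‖ ^ 2 := by gcongr
                _ = ‖v x‖ ^ 2 := one_mul _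
        _ = A := Real.sqrt_sq hA0
    gcongr
  -- the pointwise bound on the integrand
  have hF : ∀ x, |fderiv ℝ (fun y => θ y ^ 8) x (v x) * ‖v x‖ ^ 2| ≤
      8 * (C₁ / r) * (θ x ^ 7 * ‖v x‖ ^ 3) := by
    intro x
    rw [abs_mul, abs_of_nonneg (sq_nonneg ‖v x‖)]
    have h := abs_fderiv_taoCutoff_pow_eight_apply_le hC x (v x)
    calc |fderiv ℝ (fun y => θ y ^ 8) x (v x)| * ‖v x‖ ^ 2
        ≤ 8 * θ x ^ 7 * (C₁ / r) * ‖v x‖ * ‖v x‖ ^ 2 := by gcongr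
      _ = 8 * (C₁ / r) * (θ x ^ 7 * ‖v x‖ ^ 3) := by ring
  have hFi : Integrable fun x => fderiv ℝ (fun y => θ y ^ 8) x (v x) * ‖v x‖ ^ 2 := by
    refine ((((hφ1.continuous_fderiv one_ne_zero).clm_apply hvc)).mul
      (hvc.norm.fun_pow 2)).integrable_of_hasCompactSupport ?_
    refine ((hφc.fderiv ℝ).mono fun x hx => ?_).mul_right
    rw [mem_support] at hx ⊢
    contrapose! hx
    rw [hx, zero_apply]
  calc |∫ x, fderiv ℝ (fun y => θ y ^ 8) x (v x) * ‖v x‖ ^ 2|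
      ≤ ∫ x, |fderiv ℝ (fun y => θ y ^ 8) x (v x) * ‖v x‖ ^ 2| := abs_integral_le_integral_abs
    _ ≤ ∫ x, 8 * (C₁ / r) * (θ x ^ 7 * ‖v x‖ ^ 3) :=
        integral_mono hFi.abs ((integrable_taoCutoff_pow_mul (n := 7) (by norm_num) hr.le hR.le
          (hvc.norm.fun_pow 3)).const_mul _) hF
    _ = 8 * (C₁ / r) * ∫ x, θ x ^ 7 * ‖v x‖ ^ 3 := integral_const_mul _ _
    _ ≤ 8 * (C₁ / r) * (A * Real.sqrt (A * Real.sqrt (∫ x, ‖θ x ^ 4 • v x‖ ^ 6))) := by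
        gcongr

/-- **Viscous cross term ((61), the `∇η`-part of the heat flux `X₂`).** For every `δ > 0`,
`|∫ Σᵢ ∂ᵢ(θ⁸) ⟪∂ᵢv, v⟫| ≤ (δ/2) X₁ + 96 (C₁/r)² δ⁻¹ A²`
(pointwise `8θ⁷ (C₁/r) |∂ᵢv| |v| = (θ⁴|∂ᵢv|)(8 (C₁/r) θ³|v|)` and Young's inequality; Tao
integrates by parts once more and bounds `X₂ = ½∫|u|²Δ(η⁴) ≲ A²/r²`). [cite: Tao2011, §8, proof of Lemma 8.1, (61)–(62)] -/
theorem abs_integral_sum_fderiv_taoCutoff_pow_mul_inner_le (hv : ContDiff ℝ 1 v)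
    (hv2 : Integrable fun x => ‖v x‖ ^ 2) (hA : ∫ x, ‖v x‖ ^ 2 ≤ A ^ 2)
    (hr : 0 < r) (hR : 0 < R) (hC : ∀ x : ℝ³, ‖fderiv ℝ (taoCutoff R r) x‖ ≤ C₁ / r)
    (hC0 : 0 ≤ C₁) {δ : ℝ} (hδ : 0 < δ) :
    |∫ x, ∑ i, fderiv ℝ (fun y => taoCutoff R r y ^ 8) x (stdOrthonormalBasis ℝ ℝ³ i) *
        ⟪fderiv ℝ v x (stdOrthonormalBasis ℝ ℝ³ i), v x⟫| ≤
      δ / 2 * localisedDissipation (fun x => taoCutoff R r x ^ 8) v +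
        96 * (C₁ / r) ^ 2 / δ * A ^ 2 := by
  set θ : ℝ³ → ℝ := taoCutoff R r with hθ
  set b := stdOrthonormalBasis ℝ ℝ³ with hb
  have hθ0 : ∀ x, 0 ≤ θ x := fun x => taoCutoff_nonneg R r x
  have hθ1 : ∀ x, θ x ≤ 1 := fun x => taoCutoff_le_one R r x
  have hCr : 0 ≤ C₁ / r := div_nonneg hC0 hr.le
  have hvc : Continuous v := hv.continuous
  have hDvc : Continuous (fderiv ℝ v) := hv.continuous_fderiv one_ne_zero
  have hφ1 : ContDiff ℝ 1 (fun y => θ y ^ 8) := contDiff_taoCutoff_pow R r 8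
  have hφc : HasCompactSupport (fun y => θ y ^ 8) :=
    hasCompactSupport_taoCutoff_pow hR.le hr.le (by norm_num)
  have hcard : (Finset.univ : Finset (Fin (Module.finrank ℝ ℝ³))).card = 3 := by
    rw [Finset.card_univ, Fintype.card_fin, finrank_euclideanSpace_fin]
  -- pointwise bound
  have hpt : ∀ x, |∑ i, fderiv ℝ (fun y => θ y ^ 8) x (b i) * ⟪fderiv ℝ v x (b i), v x⟫| ≤
      δ / 2 * (θ x ^ 8 * FluidPDE.frobeniusNormSq (fderiv ℝ v x)) +
        96 * (C₁ / r) ^ 2 / δ * ‖v x‖ ^ 2 := by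
    intro x
    have hterm : ∀ i, |fderiv ℝ (fun y => θ y ^ 8) x (b i) * ⟪fderiv ℝ v x (b i), v x⟫| ≤
        δ / 2 * (θ x ^ 8 * ‖fderiv ℝ v x (b i)‖ ^ 2) +
          32 * (C₁ / r) ^ 2 / δ * (θ x ^ 6 * ‖v x‖ ^ 2) := by
      intro i
      have h1 := abs_fderiv_taoCutoff_pow_eight_apply_le hC x (b i)
      rw [hb, b.norm_eq_one, mul_one] at h1
      have h2 : |⟪fderiv ℝ v x (b i), v x⟫| ≤ ‖fderiv ℝ v x (b i)‖ * ‖v x‖ :=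
        abs_real_inner_le_norm _ _
      have hy := mul_le_half_mul_sq_add hδ (θ x ^ 4 * ‖fderiv ℝ v x (b i)‖)
        (8 * (C₁ / r) * θ x ^ 3 * ‖v x‖)
      have hθ7 : 0 ≤ 8 * θ x ^ 7 * (C₁ / r) := by
        have := hθ0 x
        positivity
      calc |fderiv ℝ (fun y => θ y ^ 8) x (b i) * ⟪fderiv ℝ v x (b i), v x⟫|
          = |fderiv ℝ (fun y => θ y ^ 8) x (b i)| * |⟪fderiv ℝ v x (b i), v x⟫| := abs_mul _ _
        _ ≤ 8 * θ x ^ 7 * (C₁ / r) * (‖fderiv ℝ v x (b i)‖ * ‖v x‖) :=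
            mul_le_mul h1 h2 (abs_nonneg _) hθ7
        _ = θ x ^ 4 * ‖fderiv ℝ v x (b i)‖ * (8 * (C₁ / r) * θ x ^ 3 * ‖v x‖) := by ring
        _ ≤ δ / 2 * (θ x ^ 4 * ‖fderiv ℝ v x (b i)‖) ^ 2 +
              (8 * (C₁ / r) * θ x ^ 3 * ‖v x‖) ^ 2 / (2 * δ) := hy
        _ = δ / 2 * (θ x ^ 8 * ‖fderiv ℝ v x (b i)‖ ^ 2) +
              32 * (C₁ / r) ^ 2 / δ * (θ x ^ 6 * ‖v x‖ ^ 2) := by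
            field_simp
            ring
    have hθ6 : θ x ^ 6 * ‖v x‖ ^ 2 ≤ ‖v x‖ ^ 2 := by
      have : θ x ^ 6 ≤ 1 := pow_le_one₀ (hθ0 x) (hθ1 x)
      calc θ x ^ 6 * ‖v x‖ ^ 2 ≤ 1 * ‖v x‖ ^ 2 := by gcongr
        _ = ‖v x‖ ^ 2 := one_mul _
    calc |∑ i, fderiv ℝ (fun y => θ y ^ 8) x (b i) * ⟪fderiv ℝ v x (b i), v x⟫|
        ≤ ∑ i, |fderiv ℝ (fun y => θ y ^ 8) x (b i) * ⟪fderiv ℝ v x (b i), v x⟫| :=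
          Finset.abs_sum_le_sum_abs _ _
      _ ≤ ∑ i, (δ / 2 * (θ x ^ 8 * ‖fderiv ℝ v x (b i)‖ ^ 2) +
            32 * (C₁ / r) ^ 2 / δ * (θ x ^ 6 * ‖v x‖ ^ 2)) := Finset.sum_le_sum fun i _ => hterm i
      _ = δ / 2 * (θ x ^ 8 * FluidPDE.frobeniusNormSq (fderiv ℝ v x)) +
            3 * (32 * (C₁ / r) ^ 2 / δ * (θ x ^ 6 * ‖v x‖ ^ 2)) := by
          rw [Finset.sum_add_distrib, Finset.sum_const, hcard, ← Finset.mul_sum, ← Finset.mul_sum]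
          simp [FluidPDE.frobeniusNormSq, hb]
      _ ≤ δ / 2 * (θ x ^ 8 * FluidPDE.frobeniusNormSq (fderiv ℝ v x)) +
            3 * (32 * (C₁ / r) ^ 2 / δ * ‖v x‖ ^ 2) := by gcongr
      _ = _ := by ring
  -- integrability
  have hSi : Integrable fun x => ∑ i, fderiv ℝ (fun y => θ y ^ 8) x (b i) *
      ⟪fderiv ℝ v x (b i), v x⟫ := by
    refine (continuous_finsetSum _ fun i _ => (((hφ1.continuous_fderiv one_ne_zero).clm_apply
      continuous_const)).mul ((hDvc.clm_apply continuous_const).inner hvc)).integrable_of_hasCompactSupport ?_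
    refine (hφc.fderiv ℝ).mono fun x hx => ?_
    rw [mem_support] at hx ⊢
    contrapose! hx
    simp [hx]
  have hi1 : Integrable (fun x => θ x ^ 8 * FluidPDE.frobeniusNormSq (fderiv ℝ v x)) :=
    integrable_taoCutoff_pow_mul (by norm_num) hr.le hR.le
      (FluidPDE.continuous_frobeniusNormSq_fderiv hv one_ne_zero)
  have hX₁ : ∫ x, θ x ^ 8 * FluidPDE.frobeniusNormSq (fderiv ℝ v x) =
      localisedDissipation (fun x => θ x ^ 8) v := rfl
  calc |∫ x, ∑ i, fderiv ℝ (fun y => θ y ^ 8) x (b i) * ⟪fderiv ℝ v x (b i), v x⟫|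
      ≤ ∫ x, |∑ i, fderiv ℝ (fun y => θ y ^ 8) x (b i) * ⟪fderiv ℝ v x (b i), v x⟫| :=
        abs_integral_le_integral_abs
    _ ≤ ∫ x, (δ / 2 * (θ x ^ 8 * FluidPDE.frobeniusNormSq (fderiv ℝ v x)) +
          96 * (C₁ / r) ^ 2 / δ * ‖v x‖ ^ 2) :=
        integral_mono hSi.abs ((hi1.const_mul _).add (hv2.const_mul _)) hpt
    _ = δ / 2 * localisedDissipation (fun x => θ x ^ 8) v +
          96 * (C₁ / r) ^ 2 / δ * ∫ x, ‖v x‖ ^ 2 := by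
        rw [integral_add (hi1.const_mul _) (hv2.const_mul _), integral_const_mul,
          integral_const_mul, hX₁]
    _ ≤ δ / 2 * localisedDissipation (fun x => θ x ^ 8) v + 96 * (C₁ / r) ^ 2 / δ * A ^ 2 := by
        gcongr

/-- The Gagliardo–Nirenberg–Sobolev constant of Mathlib on `ℝ³` for `p = 2` (`p* = 6`):
`‖w‖_{L⁶} ≤ K ‖∇w‖_{L²}` for `w ∈ C¹_c(ℝ³)` (`MeasureTheory.eLpNorm_le_eLpNorm_fderiv_of_eq`), as a
real number. [folklore] -/
def gnsConst3 : ℝ := (SNormLESNormFDerivOfEqConst ℝ³ (volume : Measure ℝ³) 2 : ℝ)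

/-- `0 ≤ K`. [folklore] -/
theorem gnsConst3_nonneg : 0 ≤ gnsConst3 := NNReal.coe_nonneg _

/-- **Transport term, absorbed (Tao: (63), "`X₃ ≲ A^{3/2} r⁻¹ X₁^{3/4} + A³/r^{5/2}`" and "by
Young's inequality `-½X₁ + O(A^{3/2} r⁻¹ X₁^{3/4}) ≲ A⁶/r⁴`", with the viscosity restored).**
Per slice, with `X₁ = ∫ θ⁸|∇v|²`, `∫|v|² ≤ A²`, `K = gnsConst3`:
`½ ∫ D(θ⁸)(v)|v|² ≤ (ν/8) X₁ + 2C₁² (νA²/r²) + 2²⁰ C₁⁴ K⁶ (A⁶/(ν³r⁴))`.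
[cite: Tao2011, §8, proof of Lemma 8.1, (63)–(65)] -/
theorem half_transport_le (hv : ContDiff ℝ 1 v) (hv2 : Integrable fun x => ‖v x‖ ^ 2)
    (hA : ∫ x, ‖v x‖ ^ 2 ≤ A ^ 2) (hA0 : 0 ≤ A) (hr : 0 < r) (hR : 0 < R)
    (hC : ∀ x : ℝ³, ‖fderiv ℝ (taoCutoff R r) x‖ ≤ C₁ / r) (hC0 : 0 ≤ C₁) {ν : ℝ} (hν : 0 < ν) :
    2⁻¹ * ∫ x, fderiv ℝ (fun y => taoCutoff R r y ^ 8) x (v x) * ‖v x‖ ^ 2 ≤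
      ν / 8 * localisedDissipation (fun x => taoCutoff R r x ^ 8) v +
        (2 * C₁ ^ 2 * (ν * A ^ 2 / r ^ 2) +
          1048576 * C₁ ^ 4 * gnsConst3 ^ 6 * (A ^ 6 / (ν ^ 3 * r ^ 4))) := by
  have hK0 : 0 ≤ gnsConst3 := gnsConst3_nonneg
  have hX₁0 : 0 ≤ localisedDissipation (fun x => taoCutoff R r x ^ 8) v :=
    localisedDissipation_nonneg (fun x => taoCutoff_pow_nonneg R r x 8) v
  have hI60 : 0 ≤ ∫ x, ‖taoCutoff R r x ^ 4 • v x‖ ^ 6 := integral_nonneg fun x => by positivity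
  have h1 := abs_integral_fderiv_taoCutoff_pow_apply_mul_norm_sq_le hv hv2 hA hA0 hr hR hC hC0
  have h2 : ∫ x, ‖taoCutoff R r x ^ 4 • v x‖ ^ 6 ≤
      (gnsConst3 * Real.sqrt (2 * localisedDissipation (fun x => taoCutoff R r x ^ 8) v +
        32 * (C₁ / r) ^ 2 * A ^ 2)) ^ 6 :=
    integral_norm_taoCutoff_pow_four_smul_pow_six_le hv hv2 hA hr hR hC hC0
  -- abbreviations (plain reals)
  generalize hX : localisedDissipation (fun x => taoCutoff R r x ^ 8) v = X₁ at hX₁0 h2 ⊢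
  generalize hI : ∫ x, ‖taoCutoff R r x ^ 4 • v x‖ ^ 6 = I6 at hI60 h1 h2
  generalize hT : ∫ x, fderiv ℝ (fun y => taoCutoff R r y ^ 8) x (v x) * ‖v x‖ ^ 2 = T₃ at h1 ⊢
  generalize hKK : gnsConst3 = K at hK0 h2 ⊢
  set D := Real.sqrt (2 * X₁ + 32 * (C₁ / r) ^ 2 * A ^ 2) with hD
  have hD0 : 0 ≤ D := Real.sqrt_nonneg _
  have hD2 : D ^ 2 = 2 * X₁ + 32 * (C₁ / r) ^ 2 * A ^ 2 := Real.sq_sqrt (by positivity)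
  have hKD : 0 ≤ K * D := mul_nonneg hK0 hD0
  -- `√I6 ≤ (K D)³`
  have h3 : Real.sqrt I6 ≤ (K * D) ^ 3 := by
    calc Real.sqrt I6 ≤ Real.sqrt ((K * D) ^ 6) := Real.sqrt_le_sqrt h2
      _ = (K * D) ^ 3 := by
          rw [show (K * D) ^ 6 = ((K * D) ^ 3) ^ 2 by ring, Real.sqrt_sq (by positivity)]
  -- `√(A √I6) ≤ √(A K³) √(D³)`
  have h4 : Real.sqrt (A * Real.sqrt I6) ≤ Real.sqrt (A * K ^ 3) * Real.sqrt (D ^ 3) := by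
    calc Real.sqrt (A * Real.sqrt I6) ≤ Real.sqrt (A * (K * D) ^ 3) := by gcongr
      _ = Real.sqrt (A * K ^ 3 * D ^ 3) := by ring_nf
      _ = Real.sqrt (A * K ^ 3) * Real.sqrt (D ^ 3) := Real.sqrt_mul (by positivity) _
  set M : ℝ := 8 * (C₁ / r) * (A * Real.sqrt (A * K ^ 3)) with hM
  have hM0 : 0 ≤ M := by positivity
  have h5 : |T₃| ≤ M * Real.sqrt (D ^ 3) := by
    calc |T₃| ≤ 8 * (C₁ / r) * (A * Real.sqrt (A * Real.sqrt I6)) := h1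
      _ ≤ 8 * (C₁ / r) * (A * (Real.sqrt (A * K ^ 3) * Real.sqrt (D ^ 3))) := by gcongr
      _ = M * Real.sqrt (D ^ 3) := by simp only [hM]; ring
  have h6 := mul_sqrt_pow_three_le hD0 hM0 (by positivity : 0 < ν / 8)
  -- `M⁴ = 4096 (C₁/r)⁴ A⁶ K⁶`
  have hM4 : M ^ 4 = 4096 * (C₁ / r) ^ 4 * A ^ 6 * K ^ 6 := by
    have hs : Real.sqrt (A * K ^ 3) ^ 2 = A * K ^ 3 := Real.sq_sqrt (by positivity)
    simp only [hM]
    rw [show (8 * (C₁ / r) * (A * Real.sqrt (A * K ^ 3))) ^ 4 =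
      4096 * (C₁ / r) ^ 4 * A ^ 4 * (Real.sqrt (A * K ^ 3) ^ 2) ^ 2 by ring, hs]
    ring
  have hν0 : ν ≠ 0 := hν.ne'
  have hr0 : r ≠ 0 := hr.ne'
  have h7 : 2⁻¹ * (ν / 8 * D ^ 2 + M ^ 4 / (ν / 8) ^ 3) =
      ν / 8 * X₁ + (2 * C₁ ^ 2 * (ν * A ^ 2 / r ^ 2) +
        1048576 * C₁ ^ 4 * K ^ 6 * (A ^ 6 / (ν ^ 3 * r ^ 4))) := by
    rw [hM4, hD2]
    field_simp
    ring
  calc 2⁻¹ * T₃ ≤ 2⁻¹ * |T₃| := by gcongr; exact le_abs_self _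
    _ ≤ 2⁻¹ * (M * Real.sqrt (D ^ 3)) := by gcongr
    _ ≤ 2⁻¹ * (ν / 8 * D ^ 2 + M ^ 4 / (ν / 8) ^ 3) := by gcongr
    _ = _ := h7

/-- **Viscous cross term, absorbed.** Per slice:
`-ν ∫ Σᵢ ∂ᵢ(θ⁸)⟪∂ᵢv, v⟫ ≤ (ν/8) X₁ + 384 C₁² (νA²/r²)` (the case `δ = 1/4` of
`abs_integral_sum_fderiv_taoCutoff_pow_mul_inner_le`; Tao: "`X₂ ≲ A²/r²`").
[cite: Tao2011, §8, proof of Lemma 8.1, (61)–(62)] -/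
theorem neg_viscous_cross_le (hv : ContDiff ℝ 1 v) (hv2 : Integrable fun x => ‖v x‖ ^ 2)
    (hA : ∫ x, ‖v x‖ ^ 2 ≤ A ^ 2) (hr : 0 < r) (hR : 0 < R)
    (hC : ∀ x : ℝ³, ‖fderiv ℝ (taoCutoff R r) x‖ ≤ C₁ / r) (hC0 : 0 ≤ C₁) {ν : ℝ} (hν : 0 < ν) :
    -ν * ∫ x, ∑ i, fderiv ℝ (fun y => taoCutoff R r y ^ 8) x (stdOrthonormalBasis ℝ ℝ³ i) *
        ⟪fderiv ℝ v x (stdOrthonormalBasis ℝ ℝ³ i), v x⟫ ≤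
      ν / 8 * localisedDissipation (fun x => taoCutoff R r x ^ 8) v +
        384 * C₁ ^ 2 * (ν * A ^ 2 / r ^ 2) := by
  have h := abs_integral_sum_fderiv_taoCutoff_pow_mul_inner_le hv hv2 hA hr hR hC hC0
    (by norm_num : (0 : ℝ) < 1 / 4)
  have key : ∀ {S B : ℝ}, |S| ≤ B → -ν * S ≤ ν * B := fun {S B} hSB => by
    nlinarith [neg_abs_le S]
  refine (key h).trans_eq ?_
  have hr0 : r ≠ 0 := hr.ne'
  field_simp
  ring

end Slice

/-! ## The named fact: Tao's pressure term `X₅` -/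

/-- **Tao 2011, §8, proof of Lemma 8.1: the estimate of the pressure term `X₅` (nothing
asserted).** Printed (with `ν = 1`): for the normalised pressure `p̃ = -Δ⁻¹∂ᵢ∂ⱼ(uᵢuⱼ)` ((55))
and the cutoff `η` of (58), the pressure term `X₅ = 4 ∫ u p̃ η³ ∇η` of the localised energy
identity (61) is split as `X₅ = X₅,₁ + X₅,₂` (moving `η³` past `Δ⁻¹∇²`), with
`X₅,₁ ≲ r⁻¹ ‖u‖^{3/2}_{L²} ‖uη²‖^{3/2}_{L⁶} ≲ A^{3/2} r⁻¹ X₁^{3/4} + A³/r^{5/2}` ("the singular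
integral `Δ⁻¹∇²` is bounded on `L²`", Hölder, Sobolev) and a bound for the commutator term
`X₅,₂`, after which Young's inequality absorbs `A^{3/2} r⁻¹ X₁^{3/4}` into `½ X₁` with remainder
`≲ A⁶/r⁴`, and `A³/r^{5/2} ≲ A²/r² + A⁶/r⁴`. Rendering, per velocity slice `v ∈ C^∞(ℝ³)` with
`∫ |v|² ≤ A²` (Tao's (56)), Tao's `η := θ²`, `θ = taoCutoff R r`, `0 < r < R/2` (so `η⁴ = θ⁸`
and `u·∇(η⁴) p̃ = p̃ D(θ⁸)(v)`, the pressure pairing of the tree's localised energy balance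
`Fluid.IsClassicalNSSolutionOn.energy_balance_cutoff`), `p̃ = NS.normalisedPressure v` (the
singular-integral realisation of `-Δ⁻¹∂ᵢ∂ⱼ(vᵢvⱼ)`, `NormalisedPressure.lean`), and the
absorption written out with a free parameter `ε > 0` (the `ν`-homogeneous form of Tao's
`ν = 1` bookkeeping, used with `ε = ν/4`): there is an absolute constant `C` with
`|∫ p̃[v] D(θ⁸)(v)| ≤ ε X₁ + C (ε A²/r² + A⁶/(ε³ r⁴))`, `X₁ = ∫ θ⁸ |∇v|²`.
**Caveat on the printed commutator step.** The arXiv text bounds `X₅,₂` through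
"`[Δ⁻¹∇², η³]` is a smoothing operator of infinite order … `‖[Δ⁻¹∇², η³] f‖_{L²} ≲ r^{-3/2}‖f‖_{L¹}`";
this operator bound is not correct as stated (the commutator of the order-`0` operator `Δ⁻¹∇²`
with a smooth multiplier has kernel `≍ r⁻¹|x - y|⁻²` near the diagonal, which is not square
integrable in `ℝ³`). The statement vendored HERE is the estimate of `X₅` itself, which does hold:
splitting the commutator kernel at `|x - y| = r`, the far part gives Tao's `A³ r^{-5/2}` and the
near part, paired with `|v|² ∈ L¹` and `θ⁴v ∈ L⁶` (Sobolev), gives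
`A² r^{-3/2} ‖∇(θ⁴v)‖_{L²} + A³ r^{-5/2}`, absorbed by the same Young/AM–GM step. Inputs of its
proof (next layer): the `L²` bound for `p̃` (Stein 1970, Ch. III §1), the existence of the
principal values (`NS.hasPressurePV_of_contDiff`) and elementary kernel integrals.
[cite: Tao2011, §8, proof of Lemma 8.1, (64)–(65)] -/
def tao2011_pressureTerm_estimate : Prop :=
  ∃ C : ℝ, 0 ≤ C ∧ ∀ v : ℝ³ → ℝ³, ContDiff ℝ ∞ v →
    ∀ A : ℝ, 0 ≤ A → ∫⁻ x, ‖v x‖ₑ ^ 2 ≤ ENNReal.ofReal (A ^ 2) →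
    ∀ (R r : ℝ), 0 < r → 2 * r < R → ∀ ε : ℝ, 0 < ε →
      |∫ x, normalisedPressure v x * fderiv ℝ (fun y => taoCutoff R r y ^ 8) x (v x)| ≤
        ε * localisedDissipation (fun x => taoCutoff R r x ^ 8) v +
          C * (ε * A ^ 2 / r ^ 2 + A ^ 6 / (ε ^ 3 * r ^ 4))

/-! ## From the pressure inputs to the localised energy inequality -/

section Glue

variable {R r A : ℝ} {v : ℝ³ → ℝ³}

/-- **Pressure term per slice ((54): `∇p = ∇p̃` for a.e. `t`, then `X₅`).** If the pressure slice
is `q = p̃[v] + c` (a constant shift, as provided for a.e. `t` by Lemma 4.1 (i)), then, `v` being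
divergence free, `∫ q D(θ⁸)(v) = ∫ p̃[v] D(θ⁸)(v)` (`∫ D(θ⁸)(v) = ∫ div(θ⁸ v) = 0`), and the
estimate of `X₅` with `ε = ν/4` gives
`∫ q D(θ⁸)(v) ≤ (ν/4) X₁ + (C₅/4)(νA²/r²) + 64 C₅ (A⁶/(ν³r⁴))`. [cite: Tao2011, §8, proof of Lemma 8.1, (54) and (64)–(65)] -/
theorem pressure_slice_le {C₅ : ℝ}
    (hC₅ : ∀ v : ℝ³ → ℝ³, ContDiff ℝ ∞ v →
      ∀ A : ℝ, 0 ≤ A → ∫⁻ x, ‖v x‖ₑ ^ 2 ≤ ENNReal.ofReal (A ^ 2) →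
      ∀ (R r : ℝ), 0 < r → 2 * r < R → ∀ ε : ℝ, 0 < ε →
        |∫ x, normalisedPressure v x * fderiv ℝ (fun y => taoCutoff R r y ^ 8) x (v x)| ≤
          ε * localisedDissipation (fun x => taoCutoff R r x ^ 8) v +
            C₅ * (ε * A ^ 2 / r ^ 2 + A ^ 6 / (ε ^ 3 * r ^ 4)))
    (hv : ContDiff ℝ ∞ v) (hdiv : VectorCalculus.IsDivFree v)
    (hE : ∫⁻ x, ‖v x‖ₑ ^ 2 ≤ ENNReal.ofReal (A ^ 2)) (hA0 : 0 ≤ A) (hr : 0 < r) (hrR : 2 * r < R)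
    {ν : ℝ} (hν : 0 < ν) {q : ℝ³ → ℝ} (hq : Continuous q) {c : ℝ}
    (hqc : ∀ x, q x = normalisedPressure v x + c) :
    ∫ x, q x * fderiv ℝ (fun y => taoCutoff R r y ^ 8) x (v x) ≤
      ν / 4 * localisedDissipation (fun x => taoCutoff R r x ^ 8) v +
        (C₅ / 4 * (ν * A ^ 2 / r ^ 2) + 64 * C₅ * (A ^ 6 / (ν ^ 3 * r ^ 4))) := by
  have hR : 0 < R := by linarith
  have hφ1 : ContDiff ℝ 1 fun y : ℝ³ => taoCutoff R r y ^ 8 := contDiff_taoCutoff_pow R r 8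
  have hφc : HasCompactSupport fun y : ℝ³ => taoCutoff R r y ^ 8 :=
    hasCompactSupport_taoCutoff_pow hR.le hr.le (by norm_num)
  have hv1 : ContDiff ℝ 1 v := hv.of_le (by exact_mod_cast le_top)
  have hvc : Continuous v := hv.continuous
  have hD : Continuous fun x => fderiv ℝ (fun y : ℝ³ => taoCutoff R r y ^ 8) x (v x) :=
    (hφ1.continuous_fderiv one_ne_zero).clm_apply hvc
  have hDc : HasCompactSupport fun x => fderiv ℝ (fun y : ℝ³ => taoCutoff R r y ^ 8) x (v x) := by
    refine (hφc.fderiv ℝ).mono fun x hx => ?_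
    rw [mem_support] at hx ⊢
    contrapose! hx
    rw [hx, zero_apply]
  have i1 : Integrable fun x => q x * fderiv ℝ (fun y : ℝ³ => taoCutoff R r y ^ 8) x (v x) :=
    (hq.mul hD).integrable_of_hasCompactSupport hDc.mul_left
  have i2 : Integrable fun x => c * fderiv ℝ (fun y : ℝ³ => taoCutoff R r y ^ 8) x (v x) :=
    (continuous_const.mul hD).integrable_of_hasCompactSupport hDc.mul_left
  have heq : ∫ x, normalisedPressure v x * fderiv ℝ (fun y : ℝ³ => taoCutoff R r y ^ 8) x (v x) =
      ∫ x, q x * fderiv ℝ (fun y : ℝ³ => taoCutoff R r y ^ 8) x (v x) := by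
    have : (fun x => normalisedPressure v x * fderiv ℝ (fun y : ℝ³ => taoCutoff R r y ^ 8) x (v x)) =
        fun x => q x * fderiv ℝ (fun y : ℝ³ => taoCutoff R r y ^ 8) x (v x) -
          c * fderiv ℝ (fun y : ℝ³ => taoCutoff R r y ^ 8) x (v x) := by
      funext x
      rw [hqc x]
      ring
    rw [this, integral_sub i1 i2, integral_const_mul,
      integral_fderiv_apply_eq_zero_of_isDivFree hv1 hdiv hφ1 hφc, mul_zero, sub_zero]
  have h5 := hC₅ v hv A hA0 hE R r hr hrR (ν / 4) (by positivity)
  rw [heq] at h5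
  refine (le_abs_self _).trans (h5.trans_eq ?_)
  have hν0 : ν ≠ 0 := hν.ne'
  have hr0 : r ≠ 0 := hr.ne'
  field_simp
  ring

/-- Monotonicity of the integral against a nonnegative integrable majorant, with no integrability
assumption on the minorant (if it is not integrable its integral is the junk value `0`). [folklore] -/
theorem integral_le_integral_of_le_of_nonneg {α : Type*} [MeasurableSpace α] {μ : Measure α}
    {f g : α → ℝ} (hg : Integrable g μ) (hg0 : 0 ≤ᵐ[μ] g) (hle : f ≤ᵐ[μ] g) :
    ∫ x, f x ∂μ ≤ ∫ x, g x ∂μ := by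
  by_cases hf : Integrable f μ
  · exact integral_mono_ae hf hg hle
  · rw [integral_undef hf]
    exact integral_nonneg_of_ae hg0

/-- Time integration of an a.e. slice bound `F(τ) ≤ κ X(τ) + e` over `(0, t)`:
`∫₀ᵗ F ≤ κ ∫₀ᵗ X + e t` (`X ≥ 0` integrable, `κ, e ≥ 0`; no integrability needed for `F`). [folklore] -/
theorem integral_Ioo_le_of_slice_le_ae {F X : ℝ → ℝ} {t κ e : ℝ} (ht : 0 ≤ t)
    (hX : IntegrableOn X (Ioo 0 t)) (hX0 : ∀ τ ∈ Ioo 0 t, 0 ≤ X τ) (hκ : 0 ≤ κ) (he : 0 ≤ e)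
    (h : ∀ᵐ τ ∂(volume.restrict (Ioo 0 t)), F τ ≤ κ * X τ + e) :
    ∫ τ in Ioo 0 t, F τ ≤ κ * (∫ τ in Ioo 0 t, X τ) + e * t := by
  have ht' : volume (Ioo 0 t) ≠ (⊤ : ℝ≥0∞) := by
    rw [Real.volume_Ioo]
    exact ENNReal.ofReal_ne_top
  have hg : IntegrableOn (fun τ => κ * X τ + e) (Ioo 0 t) :=
    (hX.const_mul κ).add (integrableOn_const (hs := ht'))
  have hg0 : 0 ≤ᵐ[volume.restrict (Ioo 0 t)] fun τ => κ * X τ + e := by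
    filter_upwards [ae_restrict_mem measurableSet_Ioo] with τ hτ
    exact add_nonneg (mul_nonneg hκ (hX0 τ hτ)) he
  calc ∫ τ in Ioo 0 t, F τ ≤ ∫ τ in Ioo 0 t, (κ * X τ + e) :=
        integral_le_integral_of_le_of_nonneg hg hg0 h
    _ = κ * (∫ τ in Ioo 0 t, X τ) + e * t := by
        rw [integral_add (hX.const_mul κ) (integrableOn_const (hs := ht')), integral_const_mul,
          setIntegral_const, Real.volume_real_Ioo_of_le ht, smul_eq_mul]
        ring

/-- Time integration of a pointwise slice bound `a F(τ) ≤ κ X(τ) + e` over `(0, t)`: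
`a ∫₀ᵗ F ≤ κ ∫₀ᵗ X + e t`. [folklore] -/
theorem mul_integral_Ioo_le_of_slice_le {F X : ℝ → ℝ} {t a κ e : ℝ} (ht : 0 ≤ t)
    (hX : IntegrableOn X (Ioo 0 t)) (hX0 : ∀ τ ∈ Ioo 0 t, 0 ≤ X τ) (hκ : 0 ≤ κ) (he : 0 ≤ e)
    (h : ∀ τ ∈ Ioo 0 t, a * F τ ≤ κ * X τ + e) :
    a * ∫ τ in Ioo 0 t, F τ ≤ κ * (∫ τ in Ioo 0 t, X τ) + e * t := by
  rw [← integral_const_mul]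
  refine integral_Ioo_le_of_slice_le_ae ht hX hX0 hκ he ?_
  filter_upwards [ae_restrict_mem measurableSet_Ioo] with τ hτ
  exact h τ hτ

/-- The bookkeeping of (65) integrated in time: the localised energy identity plus the three
absorbed slice bounds give `E(t) + (ν/2)∫₀ᵗ X₁ ≤ E(0) + (e_a + e_b + e_c) t`. [folklore] -/
theorem energy_assembly_arith {Et E0 I₃ I₁ I₂ IP If ν t ea eb ec K : ℝ}
    (hid : 2⁻¹ * Et - 2⁻¹ * E0 = 2⁻¹ * I₃ - ν * I₁ - ν * I₂ + IP + If) (hIf : If = 0)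
    (ha : 2⁻¹ * I₃ ≤ ν / 8 * I₁ + ea * t) (hb : -ν * I₂ ≤ ν / 8 * I₁ + eb * t)
    (hc : IP ≤ ν / 4 * I₁ + ec * t) (hsum : (ea + eb + ec) * t ≤ K * t) :
    2⁻¹ * Et + ν / 2 * I₁ ≤ 2⁻¹ * E0 + K * t := by
  nlinarith

/-- **Tao 2011, §8: (54) + (61)–(65) ⟹ the localised energy inequality.** The pressure
normalisation `NS.tao_pressure_normalisation` (Lemma 4.1 (i): `p(t) = p̃(t) + C(t)` for a.e. `t`)
and the estimate of the pressure term `tao2011_pressureTerm_estimate` imply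
`tao2011_localisedEnergyInequality` ((65) integrated in time). Proof: the localised energy
balance of the tree (`Fluid.IsClassicalNSSolutionOn.energy_balance_cutoff`, i.e. (61) integrated
over `(0, t)` against `φ = θ⁸`, forcing `f = 0`) expresses `E_{θ⁸}(t) - E_{θ⁸}(0)` as the time
integral of the transport, dissipation, viscous-cross and pressure slice terms; the first and third
are bounded for every `τ` by `half_transport_le` ((63) + Sobolev + Young) and
`neg_viscous_cross_le`, the pressure term for a.e. `τ` by `pressure_slice_le`, each with `≤ ν/8`,
`ν/8`, `ν/4` of the dissipation `X₁(τ)`; integrating in `τ` gives the claim with the absolute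
constant `C = 386 C₁² + 65 C₅ + 2²⁰ C₁⁴ K⁶` (`C₁`: (58), `K`: Sobolev, `C₅`: `X₅`).
[cite: Tao2011, §8, proof of Lemma 8.1, (61)–(65)] -/
theorem tao2011_localisedEnergyInequality_of_pressure (hP : tao_pressure_normalisation)
    (hX5 : tao2011_pressureTerm_estimate) : tao2011_localisedEnergyInequality := by
  obtain ⟨C₅, hC₅0, hC₅⟩ := hX5
  obtain ⟨C₁, hC₁0, hC₁⟩ := exists_norm_fderiv_taoCutoff_le (E := ℝ³)
  have hK0 : 0 ≤ gnsConst3 := gnsConst3_nonneg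
  refine ⟨386 * C₁ ^ 2 + C₅ + 1048576 * C₁ ^ 4 * gnsConst3 ^ 6 + 64 * C₅, by positivity, ?_⟩
  intro ν T hν hT u p hsol A hA0 hEA R r hr hrR t ht
  have hR : 0 < R := by linarith
  have hφ1 : ContDiff ℝ 1 fun x : ℝ³ => taoCutoff R r x ^ 8 := contDiff_taoCutoff_pow R r 8
  have hφc : HasCompactSupport fun x : ℝ³ => taoCutoff R r x ^ 8 :=
    hasCompactSupport_taoCutoff_pow hR.le hr.le (by norm_num)
  have hCθ : ∀ x : ℝ³, ‖fderiv ℝ (taoCutoff R r) x‖ ≤ C₁ / r := hC₁ R r hr hR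
  -- slices
  have hI : ∀ {τ}, τ ∈ Ioo 0 t → τ ∈ Icc 0 T := fun hτ => ⟨hτ.1.le, hτ.2.le.trans ht.2⟩
  have hv1 : ∀ τ ∈ Icc 0 T, ContDiff ℝ 1 (u τ) := fun τ hτ =>
    (hsol.contDiff_velocity hτ).of_le (by exact_mod_cast le_top)
  have hint : ∀ τ ∈ Icc 0 T, Integrable fun x => ‖u τ x‖ ^ 2 := fun τ hτ =>
    integrable_sq_of_lintegral_enorm_sq_lt_top (hsol.contDiff_velocity hτ).continuous
      ((hEA τ hτ).trans_lt ENNReal.ofReal_lt_top)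
  have hA2 : ∀ τ ∈ Icc 0 T, ∫ x, ‖u τ x‖ ^ 2 ≤ A ^ 2 := by
    intro τ hτ
    have h := hEA τ hτ
    rw [← ofReal_integral_norm_sq_eq_lintegral (hint τ hτ)] at h
    exact (ENNReal.ofReal_le_ofReal_iff (by positivity)).1 h
  -- the localised dissipation in time
  have hX0 : ∀ τ ∈ Ioo 0 t, 0 ≤ localisedDissipation (fun x : ℝ³ => taoCutoff R r x ^ 8) (u τ) :=
    fun τ _ => localisedDissipation_nonneg (fun x => taoCutoff_pow_nonneg R r x 8) _
  have hXi : IntegrableOn (fun τ => localisedDissipation (fun x : ℝ³ => taoCutoff R r x ^ 8) (u τ))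
      (Ioo 0 t) :=
    ((continuousOn_localisedDissipation hsol.smooth_velocity hT
      ((continuous_taoCutoff R r).fun_pow 8) (isCompact_closedBall 0 R)
      (support_taoCutoff_pow_subset hR.le hr.le (by norm_num))).integrableOn_Icc).mono_set
      (Ioo_subset_Icc_self.trans (Icc_subset_Icc_right ht.2))
  -- the localised energy balance, (61) integrated over `(0, t)`
  have hid := hsol.energy_balance_cutoff hT hφ1 hφc le_rfl ht.1 ht.2
  have hIf : (∫ τ in Ioo 0 t, ∫ x, taoCutoff R r x ^ 8 * ⟪(0 : ℝ → ℝ³ → ℝ³) τ x, u τ x⟫) = 0 := by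
    simp
  -- (a) transport
  have hIa : 2⁻¹ * (∫ τ in Ioo 0 t, ∫ x,
      fderiv ℝ (fun x : ℝ³ => taoCutoff R r x ^ 8) x (u τ x) * ‖u τ x‖ ^ 2) ≤
      ν / 8 * (∫ τ in Ioo 0 t, localisedDissipation (fun x : ℝ³ => taoCutoff R r x ^ 8) (u τ)) +
        (2 * C₁ ^ 2 * (ν * A ^ 2 / r ^ 2) +
          1048576 * C₁ ^ 4 * gnsConst3 ^ 6 * (A ^ 6 / (ν ^ 3 * r ^ 4))) * t :=
    mul_integral_Ioo_le_of_slice_le ht.1 hXi hX0 (by positivity) (by positivity) fun τ hτ =>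
      half_transport_le (hv1 τ (hI hτ)) (hint τ (hI hτ)) (hA2 τ (hI hτ)) hA0 hr hR hCθ hC₁0.le hν
  -- (b) viscous cross term
  have hIb : -ν * (∫ τ in Ioo 0 t, ∫ x, ∑ i,
      fderiv ℝ (fun x : ℝ³ => taoCutoff R r x ^ 8) x (stdOrthonormalBasis ℝ ℝ³ i) *
        ⟪fderiv ℝ (u τ) x (stdOrthonormalBasis ℝ ℝ³ i), u τ x⟫) ≤
      ν / 8 * (∫ τ in Ioo 0 t, localisedDissipation (fun x : ℝ³ => taoCutoff R r x ^ 8) (u τ)) +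
        (384 * C₁ ^ 2 * (ν * A ^ 2 / r ^ 2)) * t :=
    mul_integral_Ioo_le_of_slice_le ht.1 hXi hX0 (by positivity) (by positivity) fun τ hτ =>
      neg_viscous_cross_le (hv1 τ (hI hτ)) (hint τ (hI hτ)) (hA2 τ (hI hτ)) hr hR hCθ hC₁0.le hν
  -- (c) pressure, for a.e. `τ` by Lemma 4.1 (i)
  obtain ⟨c, -, -, hae⟩ := hP ν T hν hT u p hsol ⟨ENNReal.ofReal (A ^ 2), ENNReal.ofReal_lt_top, hEA⟩
  have hIc : (∫ τ in Ioo 0 t, ∫ x, p τ x * fderiv ℝ (fun x : ℝ³ => taoCutoff R r x ^ 8) x (u τ x)) ≤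
      ν / 4 * (∫ τ in Ioo 0 t, localisedDissipation (fun x : ℝ³ => taoCutoff R r x ^ 8) (u τ)) +
        (C₅ / 4 * (ν * A ^ 2 / r ^ 2) + 64 * C₅ * (A ^ 6 / (ν ^ 3 * r ^ 4))) * t := by
    refine integral_Ioo_le_of_slice_le_ae ht.1 hXi hX0 (by positivity) (by positivity) ?_
    have hae' := ae_restrict_of_ae_restrict_of_subset
      (Ioo_subset_Icc_self.trans (Icc_subset_Icc_right ht.2)) hae
    filter_upwards [hae', ae_restrict_mem measurableSet_Ioo] with τ hτp hτ
    exact pressure_slice_le hC₅ (hsol.contDiff_velocity (hI hτ)) (hsol.divFree τ (hI hτ))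
      (hEA τ (hI hτ)) hA0 hr hrR hν (hsol.contDiff_pressure (hI hτ)).continuous hτp
  -- the constants
  have hsum : (2 * C₁ ^ 2 * (ν * A ^ 2 / r ^ 2) +
        1048576 * C₁ ^ 4 * gnsConst3 ^ 6 * (A ^ 6 / (ν ^ 3 * r ^ 4)) +
      384 * C₁ ^ 2 * (ν * A ^ 2 / r ^ 2) +
      (C₅ / 4 * (ν * A ^ 2 / r ^ 2) + 64 * C₅ * (A ^ 6 / (ν ^ 3 * r ^ 4)))) * t ≤
      (386 * C₁ ^ 2 + C₅ + 1048576 * C₁ ^ 4 * gnsConst3 ^ 6 + 64 * C₅) *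
        (ν * A ^ 2 / r ^ 2 + A ^ 6 / (ν ^ 3 * r ^ 4)) * t := by
    refine mul_le_mul_of_nonneg_right ?_ ht.1
    have hP₁ : 0 ≤ ν * A ^ 2 / r ^ 2 := by positivity
    have hP₂ : 0 ≤ A ^ 6 / (ν ^ 3 * r ^ 4) := by positivity
    generalize ν * A ^ 2 / r ^ 2 = P₁ at hP₁ ⊢
    generalize A ^ 6 / (ν ^ 3 * r ^ 4) = P₂ at hP₂ ⊢
    have hK6 : 0 ≤ gnsConst3 ^ 6 := by positivity
    generalize gnsConst3 ^ 6 = K6 at hK6 ⊢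
    nlinarith [mul_nonneg hC₅0 hP₁, mul_nonneg hC₅0 hP₂, mul_nonneg (sq_nonneg C₁) hP₂,
      mul_nonneg (mul_nonneg (pow_nonneg hC₁0.le 4) hK6) hP₁]
  rw [localisedEnergy_def, localisedEnergy_def]
  exact energy_assembly_arith hid hIf hIa hIb hIc hsum

/-- **Lemma 8.1 from the two pressure inputs.** `NS.tao_pressure_normalisation` (Lemma 4.1 (i))
and `tao2011_pressureTerm_estimate` (the estimate of `X₅`) imply the global energy inequality
`NS.tao_finite_energy_smooth_energy_bound` (via `tao2011_localisedEnergyInequality_of_pressure`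
and the proved assembly `tao_finite_energy_smooth_energy_bound_of_localisedEnergyInequality`).
[cite: Tao2011, Lemma 8.1] -/
theorem tao_finite_energy_smooth_energy_bound_of_pressure (hP : tao_pressure_normalisation)
    (hX5 : tao2011_pressureTerm_estimate) : tao_finite_energy_smooth_energy_bound :=
  tao_finite_energy_smooth_energy_bound_of_localisedEnergyInequality
    (tao2011_localisedEnergyInequality_of_pressure hP hX5)

end Glue

end Literature.Analysis.FluidPDE
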